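import Summits.KontsevichZagierPeriods.KontsevichZagierPeriods.Theorems.LinRedNormalFormArrangementNormalFormSeparateHighCarry
import Summits.KontsevichZagierPeriods.KontsevichZagierPeriods.Theorems.LinRedNormalFormArrangementNormalFormSeparateHighCuts
import Summits.KontsevichZagierPeriods.KontsevichZagierPeriods.Theorems.LinRedNormalFormArrangementNormalFormSeparateHighResultant

/-!
# `stub_separateHigh`, case (i): codimension-2 flats disjoint from the closed base cell

(Line `janus-bands`, crux `ArrangementNormalForm`, stub `stub_separateHigh` — separation in base
dimension `≥ 3`; part `FlatsDisjoint`, valid in every base dimension `B + 2 ≥ 2`.)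

**Theorem** (`separateHigh_of_flatsDisjoint`, registered part). Let `s` be a Janus band
representation over the base `ℝ^{B+2}` with `k` fibres (literal `JJ (B+2) k` data) such that
(H1) for every pair of active letters `L_j, L_{j'}` (`e ≠ 0`) with linearly independent linear
parts, `|L_j| + |L_{j'}|` is bounded away from zero on the domain (the flat `{L_j = L_{j'} = 0}`
does not meet the closed base cell), and (H2) the numerator is bounded away from zero on the
domain. Then `[s]` is congruent modulo `KZ.relations` to a `ℤ`-combination of SEPARATED
representations (`GG (B+1) 1 k`).

Proof. Fix the pair set `P`, the constant `θ` (`‖w_q(x₀)‖ ≥ θ` for the vectors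
`w_q = L'(x₀) ℓ − L(x₀) ℓ'`, from (H1) and `SepHigh.exists_kappa`), `N = (B+1)·#P + 1` moment-curve
candidates and their `η` (`SepHigh.exists_eta`), the bounds `Λ`, `W`, and the mesh
`δ = ηθ / (2 (2Λ²W + 1))`. Dissect (rule 1a, `SepHigh.cuts`) along the active letters and the
rational grid `xᵢ = t·h` (`0 < h ≤ δ`, `|t| ≤ T`): on a piece every letter has a constant sign and
any two points are `h`-close in every base coordinate (`SepHigh.grid_close`). Pick `z₀` in the
piece; by the pigeonhole (`SepHigh.exists_good_cand`) some candidate `v` has `|⟨w_q, v⟩| ≥ η‖w_q‖`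
for all `q ∈ P`, hence every resultant of an independent pair is `≥ ηθ/2` on the piece
(`SepHigh.res_lower`), and parallel non-proportional pairs have constant non-zero resultants
(`SepHigh.res_const_of_dep`): this is the RATIO condition, and `separateHigh_direction`
(base change `x = A⁻¹x̃` with `A⁻¹ = dirAinv v`, engine, dominated numerator split) concludes.
What this file does NOT cover: flats TOUCHING the closed cell (no good direction exists; the fan
lemma of the stub) and numerators vanishing on the closed cell (the placement problem).
-/

noncomputable section

open Set MeasureTheory MvPolynomial

namespace Summit.KontsevichZagierPeriods.ArrangementNormalForm.JanusBands

open Literature.NumberTheory.Transcendental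

namespace SepHigh

open SeparatePos

/-- A uniform lower bound `θ` for the vectors `w_q(x₀)` of all independent active pairs, from
the flat condition (H1) and the quantitative independence `exists_kappa`. [folklore] -/
theorem exists_theta {n k m : ℕ} (D : Set (Fin (n + k) → ℝ)) (L : Fin m → (Fin n → ℚ) × ℚ)
    (e : Fin m → ℕ)
    (hflat : ∀ j j', e j ≠ 0 → e j' ≠ 0 →
      (∀ μ ν : ℚ, μ • (L j).1 + ν • (L j').1 = 0 → μ = 0 ∧ ν = 0) →
      ∃ c : ℝ, 0 < c ∧ ∀ z ∈ D, c ≤ |ev (L j) (fun i => z (Fin.castAdd k i))| +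
        |ev (L j') (fun i => z (Fin.castAdd k i))|) :
    ∃ θ : ℝ, 0 < θ ∧ ∀ j j', e j ≠ 0 → e j' ≠ 0 →
      (∀ μ ν : ℚ, μ • (L j).1 + ν • (L j').1 = 0 → μ = 0 ∧ ν = 0) →
      ∀ z ∈ D, θ ≤ ‖wvec (L j) (L j') (fun i => z (Fin.castAdd k i))‖ := by
  classical
  have hex : ∀ q ∈ (Finset.univ : Finset (Fin m × Fin m)), ∃ θ : ℝ, 0 < θ ∧ (e q.1 ≠ 0 → e q.2 ≠ 0 →
      (∀ μ ν : ℚ, μ • (L q.1).1 + ν • (L q.2).1 = 0 → μ = 0 ∧ ν = 0) →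
      ∀ z ∈ D, θ ≤ ‖wvec (L q.1) (L q.2) (fun i => z (Fin.castAdd k i))‖) := by
    intro q _
    by_cases hc : e q.1 ≠ 0 ∧ e q.2 ≠ 0 ∧
        ∀ μ ν : ℚ, μ • (L q.1).1 + ν • (L q.2).1 = 0 → μ = 0 ∧ ν = 0
    · obtain ⟨h1, h2, h3⟩ := hc
      obtain ⟨c, hc0, hcz⟩ := hflat q.1 q.2 h1 h2 h3
      obtain ⟨κ, hκ, hκle⟩ := exists_kappa (L q.1).1 (L q.2).1 h3
      refine ⟨κ * c, mul_pos hκ hc0, fun _ _ _ z hz => ?_⟩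
      calc κ * c ≤ κ * (|ev (L q.1) (fun i => z (Fin.castAdd k i))| +
          |ev (L q.2) (fun i => z (Fin.castAdd k i))|) :=
            mul_le_mul_of_nonneg_left (hcz z hz) hκ.le
        _ ≤ _ := hκle _ _
    · exact ⟨1, one_pos, fun h1 h2 h3 => absurd ⟨h1, h2, h3⟩ hc⟩
  obtain ⟨θ, hθ, hall⟩ := exists_pos_forall (Finset.univ : Finset (Fin m × Fin m))
    (fun q θ => e q.1 ≠ 0 → e q.2 ≠ 0 →
      (∀ μ ν : ℚ, μ • (L q.1).1 + ν • (L q.2).1 = 0 → μ = 0 ∧ ν = 0) →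
      ∀ z ∈ D, θ ≤ ‖wvec (L q.1) (L q.2) (fun i => z (Fin.castAdd k i))‖)
    (fun q _ θ θ' hq _ hle h1 h2 h3 z hz => hle.trans (hq h1 h2 h3 z hz)) hex
  exact ⟨θ, hθ, fun j j' h1 h2 h3 z hz => hall (j, j') (Finset.mem_univ _) h1 h2 h3 z hz⟩

/-- A common bound for the `ℓ¹` norms of the letter vectors. [folklore] -/
theorem exists_Lambda {n m : ℕ} (L : Fin m → (Fin n → ℚ) × ℚ) :
    ∃ Λ : ℝ, 0 ≤ Λ ∧ ∀ j, (∑ i, |((L j).1 i : ℝ)|) ≤ Λ :=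
  ⟨∑ j, ∑ i, |((L j).1 i : ℝ)|,
    Finset.sum_nonneg fun _ _ => Finset.sum_nonneg fun _ _ => abs_nonneg _,
    fun j => Finset.single_le_sum (f := fun j => ∑ i, |((L j).1 i : ℝ)|)
      (fun _ _ => Finset.sum_nonneg fun _ _ => abs_nonneg _) (Finset.mem_univ j)⟩

/-- Coordinates of the candidates are bounded by `n · N^n`. [folklore] -/
theorem abs_cand_le {n N l : ℕ} (hl : l < N) (i : Fin n) :
    |((cand n l i : ℚ) : ℝ)| ≤ n * (N : ℝ) ^ n :=
  (Finset.single_le_sum (f := fun i => |((cand n l i : ℚ) : ℝ)|) (fun _ _ => abs_nonneg _)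
    (Finset.mem_univ i)).trans (sum_abs_cand_le hl)

/-- The value of a grid form. [folklore] -/
theorem ev_grid {n : ℕ} (i : Fin n) (t : ℤ) (h : ℚ) (x : Fin n → ℝ) :
    ev ((Pi.single i 1 : Fin n → ℚ), -((t : ℚ) * h)) x = x i - (t : ℝ) * (h : ℝ) := by
  have h1 : ∀ i' : Fin n, (((Pi.single i (1 : ℚ) : Fin n → ℚ) i' : ℚ) : ℝ) * x i' =
      if i' = i then x i' else 0 := fun i' => by
    by_cases hi : i' = i
    · subst hi
      simp
    · simp [hi]
  simp only [ev, h1, Finset.sum_ite_eq', Finset.mem_univ, if_true]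
  push_cast
  ring

end SepHigh

open SeparatePos SepHigh in
/-- **`stub_separateHigh`, case of flats disjoint from the closed cell** (registered part of
`stub_separateHigh`; every base dimension `B + 2 ≥ 2`). A Janus band representation over the base
`ℝ^{B+2}` with `k` fibres (literal `JJ (B+2) k` data) such that (H1) `|L_j| + |L_{j'}|` is bounded
away from zero on the domain for every pair of active letters with linearly independent linear
parts (no codimension-2 flat of the letter arrangement meets the closed base cell) and (H2) the
numerator is bounded away from zero on the domain, is congruent modulo `KZ.relations` to a
`ℤ`-combination of separated representations `GG (B+1) 1 k`: Lebesgue-number rational dissection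
(`SepHigh.cuts`), pigeonhole choice of a good moment-curve direction per piece
(`SepHigh.exists_good_cand`, `SepHigh.res_lower`), base change and dominated separation
(`separateHigh_direction`). [Kontsevich–Zagier 2001, §1.2] -/
theorem separateHigh_of_flatsDisjoint (GG : ℕ → ℕ → ℕ → Set KZ.FormalRep) (hGG : ∀ b σ k, GG b σ k = {w : KZ.FormalRep | ∃ (m m' n₁ n₂ : ℕ) (s : KZ.IntegralRep (b + 1 + k)) (M : Fin m' → (Fin (b + 1) → ℚ) × ℚ) (L : Fin m → (Fin b → ℚ) × ℚ) (e : Fin m → ℕ) (p : MvPolynomial (Fin b) ℚ) (ℓ₁ ℓ₂ : (Fin b → ℚ) × ℚ) (a : Fin k → Option ((Fin (b + 1) → ℚ) × ℚ)) (lo hi : Fin k → Fin k ⊕ ((Fin (b + 1) → ℚ) × ℚ)), (n₁ = 0 ∨ n₂ = 0) ∧ (σ = 2 → (∀ i c, a i = some c → c.1 (Fin.last b) = 0) ∧ (∀ i c, (lo i = Sum.inr c ∨ hi i = Sum.inr c) → (c.1 (Fin.last b) = 0 ∨ c = (Pi.single (Fin.last b) 1, 0)))) ∧ Bornology.IsBounded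 s.domain ∧ s.domain = {z | (∀ j, 0 < ∑ i, ((M j).1 i : ℝ) * z (Fin.castAdd k i) + ((M j).2 : ℝ)) ∧ ∀ i, Sum.elim (fun j => z (Fin.natAdd (b + 1) j)) (fun c => ∑ i', (c.1 i' : ℝ) * z (Fin.castAdd k i') + (c.2 : ℝ)) (lo i) < z (Fin.natAdd (b + 1) i) ∧ z (Fin.natAdd (b + 1) i) < Sum.elim (fun j => z (Fin.natAdd (b + 1) j)) (fun c => ∑ i', (c.1 i' : ℝ) * z (Fin.castAdd k i') + (c.2 : ℝ)) (hi i)} ∧ EqOn s.integrand (fun z => MvPolynomial.aeval (fun i => z (Fin.castAdd k (Fin.castSucc i))) p / (∏ j, (∑ i, ((L j).1 i : ℝ) * z (Fin.castAdd k (Fin.castSucc i)) + ((L j).2 : ℝ)) ^ e j) * ((z (Fin.castAdd k (Fin.last b)) - (∑ i, (ℓ₁.1 i : ℝ) * z (Fin.castAdd k (Fin.castSucc i)) + (ℓ₁.2 : ℝ))) ^ n₁ / (z (Fin.castAdd k (Fin.last b)) - (∑ i, (ℓ₂.1 i : ℝ) * z (Fin.castAdd k (Fin.castSucc i)) + (ℓ₂.2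 : ℝ))) ^ n₂) * ∏ i, (a i).elim 1 (fun c => 1 / (z (Fin.natAdd (b + 1) i) - (∑ i', (c.1 i' : ℝ) * z (Fin.castAdd k i') + (c.2 : ℝ))))) s.domain ∧ w = KZ.of s}) (B k m m' : ℕ) (s : KZ.IntegralRep (B + 2 + k)) (M : Fin m' → (Fin (B + 2) → ℚ) × ℚ) (L : Fin m → (Fin (B + 2) → ℚ) × ℚ) (e : Fin m → ℕ) (p : MvPolynomial (Fin (B + 2)) ℚ) (a : Fin k → Option ((Fin (B + 2) → ℚ) × ℚ)) (lo hi : Fin k → Fin k ⊕ ((Fin (B + 2) → ℚ) × ℚ)) (hbd : Bornology.IsBounded s.domain) (hdom : s.domain = {z | (∀ j, 0 < ∑ i, ((M j).1 i : ℝ) * z (Fin.castAdd k i) + ((M j).2 : ℝ)) ∧ ∀ i, Sum.elim (fun j => z (Fin.natAdd (B + 2) j)) (fun c => ∑ i', (c.1 i' : ℝ) * z (Fin.castAdd k i') + (c.2 : ℝ)) (lo i) < z (Fin.natAdd (B + 2) i) ∧ z (Fin.natAdd (B + 2) i) < Sum.elim (fun j => z (Fin.natAdd (B + 2) j)) (fun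 c => ∑ i', (c.1 i' : ℝ) * z (Fin.castAdd k i') + (c.2 : ℝ)) (hi i)}) (hint : EqOn s.integrand (fun z => MvPolynomial.aeval (fun i => z (Fin.castAdd k i)) p / (∏ j, (∑ i, ((L j).1 i : ℝ) * z (Fin.castAdd k i) + ((L j).2 : ℝ)) ^ e j) * ∏ i, (a i).elim 1 (fun c => 1 / (z (Fin.natAdd (B + 2) i) - (∑ i', (c.1 i' : ℝ) * z (Fin.castAdd k i') + (c.2 : ℝ))))) s.domain) (hnum : ∃ c : ℝ, 0 < c ∧ ∀ z ∈ s.domain, c ≤ |MvPolynomial.aeval (fun i => z (Fin.castAdd k i)) p|) (hflat : ∀ j j', e j ≠ 0 → e j' ≠ 0 → (∀ μ ν : ℚ, μ • (L j).1 + ν • (L j').1 = 0 → μ = 0 ∧ ν = 0) → ∃ c : ℝ, 0 < c ∧ ∀ z ∈ s.domain, c ≤ |∑ i, ((L j).1 i : ℝ) * z (Fin.castAdd k i) + ((L j).2 : ℝ)| + |∑ i, ((L j').1 i : ℝ) * z (Fin.castAdd k i) + ((L j').2 : ℝ)|) : ∃ c ∈ AddSubgroup.closure (GG (B + 1) 1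 k), KZ.of s - c ∈ KZ.relations := by
  classical
  -- Step 0: a vanishing active letter makes the integrand zero
  by_cases hL : ∃ j, e j ≠ 0 ∧ L j = 0
  · obtain ⟨j, hej, hLj⟩ := hL
    refine ⟨0, zero_mem _, ?_⟩
    rw [sub_zero]
    refine KZ.of_mem_relations_of_eqOn_zero s fun z hz => ?_
    rw [hint hz]
    have h0 : (∑ i', ((L j).1 i' : ℝ) * z (Fin.castAdd k i') + ((L j).2 : ℝ)) ^ e j = 0 := by
      rw [hLj]
      simp [zero_pow hej]
    simp only [Pi.zero_apply]
    rw [Finset.prod_eq_zero (Finset.mem_univ j) h0, div_zero, zero_mul]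
  push Not at hL
  -- Step 1: the constants, fixed before dissecting
  obtain ⟨c₀, hc₀, hnum⟩ := hnum
  obtain ⟨R₀, hR₀⟩ := hbd.exists_norm_le
  have hcoord : ∀ z ∈ s.domain, ∀ i, |z (Fin.castAdd k i)| ≤ R₀ := fun z hz i => by
    have h1 := norm_le_pi_norm z (Fin.castAdd k i)
    rw [Real.norm_eq_abs] at h1
    exact h1.trans (hR₀ z hz)
  obtain ⟨θ, hθ, hθw⟩ := exists_theta s.domain L e hflat
  obtain ⟨Λ, hΛ0, hΛ⟩ := exists_Lambda L
  set P : Finset (Fin m × Fin m) := Finset.univ.filter fun q => e q.1 ≠ 0 ∧ e q.2 ≠ 0 ∧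
    ∀ μ ν : ℚ, μ • (L q.1).1 + ν • (L q.2).1 = 0 → μ = 0 ∧ ν = 0 with hP
  set N : ℕ := (B + 1) * P.card + 1 with hN
  have hNP : (B + 2 - 1) * P.card < N := by
    rw [hN, show B + 2 - 1 = B + 1 by omega]
    exact Nat.lt_succ_self _
  obtain ⟨η, hη, hηbad⟩ := exists_eta (B + 2) N
  set W : ℝ := ((B + 2 : ℕ) : ℝ) * (N : ℝ) ^ (B + 2) with hW
  have hW0 : 0 ≤ W := by positivity
  set δ : ℝ := η * θ / 2 / (2 * Λ * Λ * W + 1) with hδ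
  have hden : 0 < 2 * Λ * Λ * W + 1 := by positivity
  have hδ0 : 0 < δ := by positivity
  have hδle : 2 * Λ * Λ * W * δ ≤ η * θ / 2 := by
    rw [hδ, mul_div_assoc', div_le_iff₀ hden]
    nlinarith [mul_nonneg (mul_nonneg (mul_nonneg (by norm_num : (0 : ℝ) ≤ 2) hΛ0) hΛ0) hW0,
      mul_pos hη hθ]
  obtain ⟨mesh, hmesh0, hmeshδ⟩ : ∃ mesh : ℚ, 0 < mesh ∧ (mesh : ℝ) ≤ δ := by
    obtain ⟨q, hq0, hqδ⟩ := exists_rat_btwn hδ0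
    exact ⟨q, by exact_mod_cast hq0, hqδ.le⟩
  have hmesh0' : (0 : ℝ) < mesh := by exact_mod_cast hmesh0
  set T : ℕ := ⌈R₀ / mesh⌉₊ with hT
  have hTR : R₀ ≤ T * (mesh : ℝ) := by
    have := Nat.le_ceil (R₀ / mesh)
    rw [← hT] at this
    rwa [div_le_iff₀ hmesh0'] at this
  -- the cut set: active letters and the grid
  set S : Finset ((Fin (B + 2) → ℚ) × ℚ) := (Finset.univ.filter fun j => e j ≠ 0).image L ∪
    ((Finset.univ : Finset (Fin (B + 2))) ×ˢ Finset.Icc (-(T : ℤ)) T).image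
      (fun it => ((Pi.single it.1 1 : Fin (B + 2) → ℚ), -((it.2 : ℚ) * mesh))) with hS
  have hS0 : (0 : (Fin (B + 2) → ℚ) × ℚ) ∉ S := by
    intro h0
    rcases Finset.mem_union.1 h0 with h0 | h0
    · obtain ⟨j, hj, hj0⟩ := Finset.mem_image.1 h0
      exact hL j (Finset.mem_filter.1 hj).2 hj0
    · obtain ⟨it, -, hit⟩ := Finset.mem_image.1 h0
      have := congr_arg (fun c : (Fin (B + 2) → ℚ) × ℚ => c.1 it.1) hit
      simp at this
  have hSL : ∀ j, e j ≠ 0 → L j ∈ S := fun j hej =>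
    Finset.mem_union_left _ (Finset.mem_image_of_mem L (Finset.mem_filter.2 ⟨Finset.mem_univ j, hej⟩))
  have hSg : ∀ (i : Fin (B + 2)) (t : ℤ), -(T : ℤ) ≤ t → t ≤ T →
      ((Pi.single i 1 : Fin (B + 2) → ℚ), -((t : ℚ) * mesh)) ∈ S := fun i t ht ht' =>
    Finset.mem_union_right _ (Finset.mem_image.2 ⟨(i, t), Finset.mem_product.2
      ⟨Finset.mem_univ i, Finset.mem_Icc.2 ⟨ht, ht'⟩⟩, rfl⟩)
  -- Step 2: dissect
  obtain ⟨c, hc, hrel⟩ := cuts L e p a lo hi S hS0 m' M s hbd hdom hint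
  suffices hpieces : ∀ w ∈ Pieces (B + 2) k m L e p a lo hi S m' M,
      ∃ c' ∈ AddSubgroup.closure (GG (B + 1) 1 k), w - c' ∈ KZ.relations by
    obtain ⟨c', hc', hcc⟩ := SepTwoZero.closure_transfer' hpieces c hc
    refine ⟨c', hc', ?_⟩
    have := add_mem hrel hcc
    rwa [sub_add_sub_cancel] at this
  -- Step 3: one piece
  rintro w ⟨m₁, M₁, s₁, hold, hnew, hbd₁, hdom₁, hint₁, rfl⟩
  have hsub : s₁.domain ⊆ s.domain := by
    rw [hdom₁, hdom]
    exact piece_subset M M₁ lo hi hold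
  rcases s₁.domain.eq_empty_or_nonempty with hemp | ⟨z₀, hz₀⟩
  · refine ⟨0, zero_mem _, ?_⟩
    rw [sub_zero]
    exact KZ.of_mem_relations_of_eqOn_zero s₁ fun z hz => by simp [hemp] at hz
  set x₀ : Fin (B + 2) → ℝ := fun i => z₀ (Fin.castAdd k i) with hx₀
  have hsign : ∀ g ∈ S, (∀ z ∈ s₁.domain, 0 < ev g (fun i => z (Fin.castAdd k i))) ∨
      (∀ z ∈ s₁.domain, ev g (fun i => z (Fin.castAdd k i)) < 0) := fun g hg => by
    have := piece_sign (k := k) M₁ lo hi g (hnew g hg)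
    rw [← hdom₁] at this
    exact this
  -- two points of the piece are `δ`-close in every base coordinate
  have hclose : ∀ z ∈ s₁.domain, ∀ i, |z (Fin.castAdd k i) - x₀ i| ≤ δ := by
    intro z hz i
    refine (le_of_lt (grid_close hmesh0' (hcoord z (hsub hz) i) (hcoord z₀ (hsub hz₀) i) hTR
      fun t ht ht' => ?_)).trans hmeshδ
    rcases hsign _ (hSg i t ht ht') with hpos | hneg
    · have h1 := hpos z hz
      have h2 := hpos z₀ hz₀
      rw [ev_grid] at h1 h2
      exact Or.inl ⟨h1, h2⟩
    · have h1 := hneg z hz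
      have h2 := hneg z₀ hz₀
      rw [ev_grid] at h1 h2
      exact Or.inr ⟨h1, h2⟩
  -- the good candidate direction for this piece
  have hwq : ∀ q ∈ P, wvec (L q.1) (L q.2) x₀ ≠ 0 := fun q hq => by
    obtain ⟨h1, h2, h3⟩ := (Finset.mem_filter.1 hq).2
    have := hθw q.1 q.2 h1 h2 h3 z₀ (hsub hz₀)
    exact norm_pos_iff.1 (hθ.trans_le this)
  obtain ⟨l, hl, hgood⟩ := exists_good_cand hηbad P (fun q => wvec (L q.1) (L q.2) x₀) hwq hNP
  set v : Fin (B + 2) → ℚ := cand (B + 2) l with hv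
  have hWv : ∀ i, |(v i : ℝ)| ≤ W := fun i => abs_cand_le hl i
  obtain ⟨hA', hA⟩ := dirAinv_mul_inv (n := B + 1) v (cand_last_ne_zero (B + 1) l)
  -- the resultant bound on the piece: independent pairs by the good direction, parallel pairs
  -- by constancy
  have hres : ∀ j j', e j ≠ 0 → e j' ≠ 0 → dv (L j) v ≠ 0 → dv (L j') v • L j ≠ dv (L j) v • L j' →
      ∃ ρ : ℝ, 0 < ρ ∧ ∀ z ∈ s₁.domain, ρ ≤ |res (L j) (L j') v (fun i => z (Fin.castAdd k i))| := by
    intro j j' hej hej' hα hne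
    by_cases hind : ∀ μ ν : ℚ, μ • (L j).1 + ν • (L j').1 = 0 → μ = 0 ∧ ν = 0
    · have hq : (j, j') ∈ P := Finset.mem_filter.2 ⟨Finset.mem_univ _, hej, hej', hind⟩
      have hg : η * ‖wvec (L j) (L j') x₀‖ ≤ |pair (wvec (L j) (L j') x₀) v| := hgood (j, j') hq
      have hθ' : θ ≤ ‖wvec (L j) (L j') x₀‖ := hθw j j' hej hej' hind z₀ (hsub hz₀)
      refine ⟨η * θ / 2, half_pos (mul_pos hη hθ), fun z hz => ?_⟩
      exact res_lower (L j) (L j') v x₀ hg hθ' hη.le (hΛ j) (hΛ j') hWv hW0 hδ0.le hδle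
        (hclose z hz)
    · obtain ⟨ρ, hρ, hρle⟩ := res_const_of_dep (L j) (L j') v hind hα hne
      exact ⟨ρ, hρ, fun z _ => hρle _⟩
  have hpole₁ : ∀ j, e j ≠ 0 → ∀ z ∈ s₁.domain, ev (L j) (fun i => z (Fin.castAdd k i)) ≠ 0 := by
    intro j hej z hz
    rcases hsign (L j) (hSL j hej) with hpos | hneg
    · exact (hpos z hz).ne'
    · exact (hneg z hz).ne
  have hrat₁ : ∀ j j', e j ≠ 0 → e j' ≠ 0 → dv (L j) v ≠ 0 → dv (L j') v • L j ≠ dv (L j) v • L j' →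
      ∃ C : ℝ, ∀ z ∈ s₁.domain, |ev (L j') (fun i => z (Fin.castAdd k i))| ≤
        C * |res (L j) (L j') v (fun i => z (Fin.castAdd k i))| := by
    intro j j' hej hej' hα hne
    obtain ⟨ρ, hρ, hρle⟩ := hres j j' hej hej' hα hne
    set Rb : ℝ := (∑ i, |((L j').1 i : ℝ)|) * R₀ + |((L j').2 : ℝ)| with hRb
    have hRb' : ∀ z ∈ s₁.domain, |ev (L j') (fun i => z (Fin.castAdd k i))| ≤ Rb := fun z hz =>
      abs_ev_le (L j') (hcoord z (hsub hz))
    refine ⟨Rb / ρ, fun z hz => ?_⟩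
    rw [div_mul_eq_mul_div, le_div_iff₀ hρ]
    exact mul_le_mul (hRb' z hz) (hρle z hz) hρ.le ((abs_nonneg _).trans (hRb' z hz))
  -- Step 4: base change along `v`, engine, numerator split
  refine separateHigh_direction GG hGG B k m m₁ s₁ M₁ L e p a lo hi hbd₁ hdom₁ hint₁
    (dirAinv v)⁻¹ (dirAinv v) hA hA' (fun j _ hej z hz => hpole₁ j hej z hz)
    (fun j j' hα _ hej hej' hne => ?_) ⟨c₀, hc₀, fun z hz => hnum z (hsub hz)⟩
  rw [vecMul_dirAinv_last] at hα hne
  rw [vecMul_dirAinv_last] at hne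
  rw [vecMul_dirAinv_last, vecMul_dirAinv_last]
  exact hrat₁ j j' hej hej' hα hne

end Summit.KontsevichZagierPeriods.ArrangementNormalForm.JanusBands
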